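import Mathlib
import Summits.HubbardSuperconductivity.HubbardSuperconductivity.Theorems.LevyLogBootstrapBlock2InfDivXXZFourCheckB

/-!
# Crux `Block2InfDivXXZ` (stmt-HubbardSuperconductivity-15048), `M = 4` slice: kernel facts,
# static tables (hop/diagonal, raise–lower tables, row sums)
-/

set_option linter.dupNamespace false
set_option linter.style.longLine false

namespace Summit.HubbardSuperconductivity.HubbardSuperconductivity.Theorems.LevyLogBootstrap

namespace FourCert

set_option maxRecDepth 100000
/-- `staticCheckHop` holds. -/
theorem fact_hop : staticCheckHop = true := by decide +kernel
/-- `staticCheckT 1` holds. -/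
theorem fact_T1 : staticCheckT 1 = true := by decide +kernel
/-- `staticCheckT 2` holds. -/
theorem fact_T2 : staticCheckT 2 = true := by decide +kernel
/-- `staticCheckT 3` holds. -/
theorem fact_T3 : staticCheckT 3 = true := by decide +kernel
/-- `staticCheckT 4` holds. -/
theorem fact_T4 : staticCheckT 4 = true := by decide +kernel
/-- `rowCheckT 1` holds. -/
theorem fact_rowT1 : rowCheckT 1 = true := by decide +kernel
/-- `rowCheckT 2` holds. -/
theorem fact_rowT2 : rowCheckT 2 = true := by decide +kernel
/-- `rowCheckT 3` holds. -/
theorem fact_rowT3 : rowCheckT 3 = true := by decide +kernel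
/-- `rowCheckT 4` holds. -/
theorem fact_rowT4 : rowCheckT 4 = true := by decide +kernel

end FourCert

end Summit.HubbardSuperconductivity.HubbardSuperconductivity.Theorems.LevyLogBootstrap
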